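import Summits.Langlands.Langlands.Theses.QuadraticWindow
import HarnessLib

/-!
# `QuadraticWindow.HostInducedRep` sliced by the rank (route-posited definitions)

Crux `Summit.Langlands.Langlands.Theses.QuadraticWindow.HostInducedRep` (item stmt-Langlands-10902, route
`QuadraticWindow`, line `one-transparent-pane`) quantifies over the rank `n : ℕ` of the cuspidal
representation `π` of `GL_n(𝔸_F)`.  This definitions file records the crux WITH THE RANK FIXED,
`HostInducedRepAt n` (the body is the crux's, verbatim, with the binder `(n : ℕ)` pulled out), and the
definitional slicing `HostInducedRep ↔ ∀ n, HostInducedRepAt n`.  Purpose: the strata `n = 0` (vacuous) and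
`n = 1` (class field theory + Weil's `ℓ`-adic characters + induction of characters) are THEOREMS of the tree
(file `QuadraticWindowHostInducedRepRankOne.lean`), so that the conditional closure of the crux can be
stated honestly as "ranks `≤ 1` unconditionally, ranks `≥ 2` modulo the published inputs".  The definition
is the one of the disprover's crux workfile `Cruxes/HostInducedRep/Disproof.lean` §1 (not importable under
`Theorems/`), moved here unchanged.

Nothing else is defined here (no new mathematics; `HostInducedRepAt` is a `Prop`-valued specialisation of
an audited route item).
-/

set_option linter.dupNamespace false -- the summit-side namespace `Summit.Langlands.Langlands.…` repeats `Langlands` by design (D-0017 single-conjunct summit)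

namespace Summit.Langlands.Langlands.Theorems.HostInducedRep.Slices

open Summit.Langlands.Langlands.Theses.QuadraticWindow

/-- **The crux `HostInducedRep` at a fixed rank `n`** (verbatim body of
`Summit.Langlands.Langlands.Theses.QuadraticWindow.HostInducedRep` with the binder `(n : ℕ)` fixed): for
`F/F₀` quadratic over the totally real `F₀` with non-trivial automorphism `τ`, every cuspidal regular
algebraic `τ`-polarized parity-normalised `π` on `GL_n(𝔸_F)`, every good prime `ℓ` with `ι : ℚ̄_ℓ ≃ ℂ` and
every admissible Artin avatar `eψ`, there is a semisimple `R : Γ_{F₀} → GL_{2n}(ℚ̄_ℓ)` unramified with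
the induced Frobenius polynomial `∏_{w ∣ v} P_w(X^{f(w∣v)})` at every good place `v` of `F₀`.
(Definition of `Cruxes/HostInducedRep/Disproof.lean` §1, moved under `Theorems/`.) -/
def HostInducedRepAt (n : ℕ) : Prop :=
  ∀ (F₀ F : Type) [Field F₀] [NumberField F₀] [Field F] [NumberField F] [Algebra F₀ F] (τ : F ≃ₐ[F₀] F), NumberField.IsTotallyReal F₀ → Module.finrank F₀ F = 2 → τ ≠ 1 → ∀ (hcpt : Literature.NumberTheory.Automorphic.isCompact_glFiniteIntegralLevel n F) (π : Literature.NumberTheory.Automorphic.CuspidalAutomorphicRepData n F hcpt) (e : Literature.NumberTheory.GaloisRepresentations.FramedGaloisRep F₀ ℂ 1) (k : ℤ), π.1.IsRegularAlgebraic → (∀ᶠ w in Filter.cofinite, ∀ (α β : Multiset ℂ) (c : ℂ), π.1.HasSatakeParamAt w α → π.1.HasSatakeParamAt (τ • w) β → e.HasFrobCharpolyAt (w.under (NumberField.RingOfIntegers F₀)) (Polynomial.X - Polynomial.C c) → β = α.map (fun a ↦ a⁻¹ * (c * ((w.under (NumberField.RingOfIntegers F₀)).residueCard : ℂ) ^ k)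 ^ w.asIdeal.inertiaDeg (NumberField.RingOfIntegers F₀))) → ((e.restrictField F).IsOdd ∨ ∀ (φ : F →+* ℝ) (c : Field.absoluteGaloisGroup F), Literature.NumberTheory.GaloisRepresentations.IsComplexConjugation φ c → Matrix.GeneralLinearGroup.det ((e.restrictField F) c) = 1) → (Odd n → (e.restrictField F).IsOdd) → ∀ (ℓ : ℕ) [Fact ℓ.Prime] (ι : PadicAlgCl ℓ ≃+* ℂ), ¬ ((ℓ : ℤ) ∣ NumberField.discr F) → (∀ w : IsDedekindDomain.HeightOneSpectrum (NumberField.RingOfIntegers F), ((ℓ : ℕ) : NumberField.RingOfIntegers F) ∈ w.asIdeal → π.1.IsUnramifiedAt w) → ∀ eψ : Literature.NumberTheory.GaloisRepresentations.FramedGaloisRep F ℂ 1, (∀ w : IsDedekindDomain.HeightOneSpectrum (NumberField.RingOfIntegers F), ((ℓ : ℕ) : NumberField.RingOfIntegers F) ∈ w.asIdeal → eψ.IsUnramifiedAt w) → (∀ (φ : F →+* ℝ) (c c' : Field.absoluteGaloisGroup F), Literature.NumberTheory.GaloisRepresentations.IsComplexConjugation φ c → Literature.NumberTheory.GaloisRepresentations.IsComplexConjugation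 (φ.comp (τ : F →+* F)) c' → Matrix.GeneralLinearGroup.det (eψ c) = Matrix.GeneralLinearGroup.det (eψ c')) → (∃ᶠ w in Filter.cofinite, ∃ (α β : Multiset ℂ) (c c' : ℂ), π.1.HasSatakeParamAt w α ∧ π.1.HasSatakeParamAt (τ • w) β ∧ eψ.HasFrobCharpolyAt w (Polynomial.X - Polynomial.C c) ∧ eψ.HasFrobCharpolyAt (τ • w) (Polynomial.X - Polynomial.C c') ∧ β.map (fun b ↦ b * c') ≠ α.map (fun a ↦ a * c)) → ∃ R : Literature.NumberTheory.GaloisRepresentations.FramedGaloisRep F₀ (PadicAlgCl ℓ) (2 * n), R.toGaloisRep.IsSemisimple ∧ ∀ (v : IsDedekindDomain.HeightOneSpectrum (NumberField.RingOfIntegers F₀)) (α : _ → Multiset ℂ) (c : _ → ℂ), ((ℓ : ℕ) : NumberField.RingOfIntegers F₀) ∉ v.asIdeal → (∀ w : IsDedekindDomain.HeightOneSpectrum (NumberField.RingOfIntegers F), w.under (NumberField.RingOfIntegers F₀) = v → w.asIdeal.ramificationIdx (NumberField.RingOfIntegers F₀) = 1 ∧ π.1.HasSatakeParamAt w (α w)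 ∧ eψ.IsUnramifiedAt w ∧ eψ.HasFrobCharpolyAt w (Polynomial.X - Polynomial.C (c w))) → R.IsUnramifiedAt v ∧ R.HasFrobCharpolyAt v (∏ᶠ w ∈ {w : IsDedekindDomain.HeightOneSpectrum (NumberField.RingOfIntegers F) | w.under (NumberField.RingOfIntegers F₀) = v}, Polynomial.expand (PadicAlgCl ℓ) (w.asIdeal.inertiaDeg (NumberField.RingOfIntegers F₀)) (Literature.NumberTheory.Automorphic.arithFrobPolyOfSatake ι w.residueCard n ((α w).map (fun a ↦ a * c w))))

/-- **Slicing by the rank is definitional**: the crux is the conjunction of its rank strata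
(registered anchor `slices_anchor` of item stmt-Langlands-10902). -/
theorem slices_anchor : HostInducedRep ↔ ∀ n, HostInducedRepAt n :=
  ⟨fun h n F₀ F _ _ _ _ _ τ hTR hdeg hτ => h F₀ F τ hTR hdeg hτ n,
    fun h F₀ F _ _ _ _ _ τ hTR hdeg hτ n => h n F₀ F τ hTR hdeg hτ⟩

/-- The stratum projection: the crux gives each of its rank strata. -/
theorem hostInducedRepAt_of_hostInducedRep (h : HostInducedRep) (n : ℕ) : HostInducedRepAt n :=
  slices_anchor.mp h n

end Summit.Langlands.Langlands.Theorems.HostInducedRep.Slices
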